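import Mathlib
import Summits.Ventures.PercRepro2.HCov
import Summits.Ventures.PercRepro2.EdgeCubic
import Summits.Ventures.PercRepro2.EdgeCubicAll
import Summits.Ventures.PercRepro2.RootEdgeBernSwap
import Summits.Ventures.PercRepro2.CPolarA3
import Summits.Ventures.PercRepro2.CPolarA3Marks
import Summits.Ventures.PercRepro2.PendantClusterBern

/-!
# One good edge per instance suffices: the weakest form of the CPOLAR hypothesis for the crux
(blind cell PercRepro2, p5 g15; `proofs/P5-OEDGE.md` §17)

The inductions of CPolarA3 / CPolarA3Marks / PendantClusterBern pin ONE fractional edge touching the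
mark-free reach of `a₃` per step, so the crux needs the one-edge Bernstein positivity at ONE such edge
per instance, not at all of them. `GoodEdge` is an edge the induction can take for free: a root edge at
`a₃` (RootEdgeBern), a pendant-PA edge (PendantClusterBern), or an edge with `0 ≤ B1 ∧ 0 ≤ B2`;
**`HCov_of_bern_a3_exists`** runs the induction on the hypothesis «every mark-free admissible weight
vector with a fractional edge touching the reach has a good one», and
**`HCov_all_of_cpolarA3Exists_all : CPolarA3Exists_all R → HCov_all R`** is the crux from it
(`cpolarA3Exists_all_of_cpolarA3NP_all`: weaker than `CPolarA3NP_all`).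
-/

namespace Summit.Ventures.PercRepro2

open UnionCluster CovForm CovForm.CPolarA3 PendantCluster

namespace CPolarA3Exists

section Induction

variable {V : Type*} {E : Type*} [Fintype V] [DecidableEq V] [Fintype E] [DecidableEq E]
  {R : Type*} [Field R] [LinearOrder R] [IsStrictOrderedRing R]

open EdgeLine

/-- An edge the induction can take: a root edge at `a₃`, a pendant-PA edge, or an edge whose two
Bernstein coefficients are nonnegative. -/
def GoodEdge (q : E → R) (ends : E → Sym2 V) (o a₁ a₂ a₃ b : V) (e : E) : Prop :=
  RootEdge.IsRootEdge ends a₁ a₂ a₃ e ∨ PendantPA q ends o a₁ a₂ a₃ e ∨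
    (0 ≤ B1 q ends o a₁ a₂ a₃ b e ∧ 0 ≤ B2 q ends o a₁ a₂ a₃ b e)

/-- **(HCOV) when every mark-free admissible weight vector with a fractional edge touching the reach
of `a₃` has a GOOD fractional edge touching the reach.** -/
theorem HCov_of_bern_a3_exists (ends : E → Sym2 V) (o a₁ a₂ a₃ b : V)
    (hB : ∀ q : E → R, IsProbVec q → MarkFree q ends o a₁ a₂ a₃ b →
      (∃ e ∈ fracEdges q, TouchesReach q ends a₃ e) →
      ∃ e ∈ fracEdges q, TouchesReach q ends a₃ e ∧ GoodEdge q ends o a₁ a₂ a₃ b e)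
    (p : E → R) (hp : IsProbVec p) : HCov p ends o a₁ a₂ a₃ b := by
  generalize hn : (fracEdges p).card = n
  induction n using Nat.strong_induction_on generalizing p with
  | _ n ih =>
    by_cases hm : a₁ ∈ pinnedReach p ends a₃ ∨ a₂ ∈ pinnedReach p ends a₃ ∨
        o ∈ pinnedReach p ends a₃ ∨ b ∈ pinnedReach p ends a₃
    · exact HCov_of_mark_mem_pinnedReach hp hm
    · have hfree : MarkFree p ends o a₁ a₂ a₃ b := by
        simp only [not_or] at hm
        exact ⟨hm.1, hm.2.1, hm.2.2.1, hm.2.2.2⟩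
      by_cases h : ∃ e ∈ fracEdges p, TouchesReach p ends a₃ e
      · obtain ⟨e, he, _, hgood⟩ := hB p hp hfree h
        have hlt : ((fracEdges p).erase e).card < n := by
          rw [← hn]; exact Finset.card_erase_lt_of_mem he
        have hp₀ : IsProbVec (Function.update p e 0) := hp.update e le_rfl zero_le_one
        have hp₁ : IsProbVec (Function.update p e 1) := hp.update e zero_le_one le_rfl
        have h₀ : HCov (Function.update p e 0) ends o a₁ a₂ a₃ b :=
          ih _ hlt (Function.update p e 0) hp₀ (by rw [fracEdges_update p e 0 (Or.inl rfl)])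
        have h₁ : HCov (Function.update p e 1) ends o a₁ a₂ a₃ b :=
          ih _ hlt (Function.update p e 1) hp₁ (by rw [fracEdges_update p e 1 (Or.inr rfl)])
        have hfe : p e ≠ 0 ∧ p e ≠ 1 := by simpa [fracEdges] using he
        rcases hgood with hr | hpa | ⟨hB1, hB2⟩
        · exact HCov_of_update_zero_of_bern p hp ends o a₁ a₂ a₃ b e h₀ h₁
            (RootEdge.B1_nonneg_of_isRootEdge p hp ends o a₁ a₂ a₃ b e hr h₀)
            (RootEdge.B2_nonneg_of_isRootEdge p hp ends o a₁ a₂ a₃ b e hr)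
        · obtain ⟨hK, z, u, hends, hz, hu, hD, hcov⟩ := hpa
          exact HCov_cluster_of_cov_nonneg p hp hK hends hz hu hfe.2 hfree.1 hfree.2.1
            hfree.2.2.1 hfree.2.2.2 hD h₀ h₁ hcov
        · exact HCov_of_update_zero_of_bern p hp ends o a₁ a₂ a₃ b e h₀ h₁ hB1 hB2
      · simp only [not_exists, not_and] at h
        exact HCov_of_reach_pinned p hp ends o a₁ a₂ a₃ b h

end Induction

section Closure

variable (R : Type*) [Field R] [LinearOrder R] [IsStrictOrderedRing R]

/-- **One good `a₃`-edge per instance**: every mark-free admissible weight vector on every finite graph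
that has a fractional edge touching the reach of `a₃` has a GOOD one (`GoodEdge`). -/
def CPolarA3Exists_all : Prop :=
  ∀ (V E : Type) [Fintype V] [DecidableEq V] [Fintype E] [DecidableEq E]
    (ends : E → Sym2 V) (p : E → R), IsProbVec p →
    ∀ o a₁ a₂ a₃ b : V, a₁ ≠ a₂ → a₁ ≠ a₃ → a₂ ≠ a₃ → o ≠ a₁ → o ≠ a₂ → o ≠ a₃ → o ≠ b →
      b ≠ a₁ → b ≠ a₂ → b ≠ a₃ → MarkFree p ends o a₁ a₂ a₃ b →
      (∃ e ∈ fracEdges p, TouchesReach p ends a₃ e) →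
      ∃ e ∈ fracEdges p, TouchesReach p ends a₃ e ∧ GoodEdge p ends o a₁ a₂ a₃ b e

omit [IsStrictOrderedRing R] in
/-- `CPolarA3Exists_all` is weaker than `CPolarA3NP_all`. -/
theorem cpolarA3Exists_all_of_cpolarA3NP_all (h : CPolarA3NP_all R) : CPolarA3Exists_all R := by
  intro V E _ _ _ _ ends p hp o a₁ a₂ a₃ b h1 h2 h3 h4 h5 h6 h7 h8 h9 h10 hfree hex
  obtain ⟨e, he, ht⟩ := hex
  refine ⟨e, he, ht, ?_⟩
  by_cases hr : RootEdge.IsRootEdge ends a₁ a₂ a₃ e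
  · exact Or.inl hr
  · by_cases hpa : PendantPA p ends o a₁ a₂ a₃ e
    · exact Or.inr (Or.inl hpa)
    · have hfe : p e ≠ 0 ∧ p e ≠ 1 := by simpa [fracEdges] using he
      exact Or.inr (Or.inr
        (h V E ends p hp o a₁ a₂ a₃ b h1 h2 h3 h4 h5 h6 h7 h8 h9 h10 hfree e hfe.1 hfe.2 ht hr hpa))

/-- **One good `a₃`-edge per instance implies the crux.** -/
theorem HCov_all_of_cpolarA3Exists_all (h : CPolarA3Exists_all R) : HCov_all R := by
  intro V E _ _ _ _ ends p hp o a₁ a₂ a₃ b h1 h2 h3 h4 h5 h6 h7 h8 h9 h10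
  exact HCov_of_bern_a3_exists ends o a₁ a₂ a₃ b
    (fun q hq hfree hex => h V E ends q hq o a₁ a₂ a₃ b h1 h2 h3 h4 h5 h6 h7 h8 h9 h10 hfree hex)
    p hp

end Closure

end CPolarA3Exists

end Summit.Ventures.PercRepro2
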